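import Summits.Langlands.Langlands.Theorems.SqrtFiveQuarticCoversW5DescentCurve
import HarnessLib

/-!
# Route `Langlands/SqrtFiveQuarticCovers`, sheet 4.5 (`CertB3E7`, stmt-Langlands-23416), row 8:
# the square classes `α(W⁵(ℚ)) ⊆ {[1],[−8575]}`, `α′(W⁵′(ℚ)) ⊆ {[1],[2195200]}` and
# FINITENESS (rank `0`) of `W⁵(ℚ)`, `W⁵ : Y² = X³ + 1470X² − 8575X`

Cell lg-quartmod (F-L1), seat eng-7 g5; module 3/4 toward the kernel theorem
`hQ5 : ∀ X Y : ℚ, Y² = X³ + 1470X² − 8575X → X = 0` (the `5`-twist of Cremona `49a4`, conductor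
`1225`; the `ℚ`-form of row 8 of the NAMED-INPUT TABLE, `…CertB3E7MordellWeilQ.lean` p677449).
Verbatim the design of `Literature/NumberTheory/EllipticCurves/Curve49A1Points.lean` (49a1) /
`X1FourteenMordellWeil.lean` / `KubertTwoTenProofs.lean`:

* `W5Descent.sq_or_mul_sq` — **`α(W⁵(ℚ)) ⊆ {[1], [b]}`**, `b = −8575 = −5²·7³` (`[b] = [−7]`): a
  rational point `(x, y)`, `x ≠ 0`, has `x` or `−8575·x` a rational square.  `v_p(x)` is even for
  `p ∉ {5, 7}` (`even_padicValRat_of_twoTorsionNF`), so `±x ∈ {1, 5, 7, 35}·ℚ²`; of the eight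
  sign/parity classes, `[1]` and `[−7]` are the conclusion, `[−1]`, `[5]`, `[−5]` are the dead
  torsors of `…W5DescentLocal.lean` (in curve coordinates: `…W5DescentCurve.lean`), and `[7]`, `[35]`, `[−35]` are carried onto them by
  translation by `T = (0,0)`, `(x, y) ↦ (−8575/x, 8575y/x²)` (which multiplies the class by
  `[b] = [−7]`).
* `W5Descent.codomain_sq_or_mul_sq` — **`α′(W⁵′(ℚ)) ⊆ {[1], [b′]}`** for the `2`-isogenous curve
  `W⁵′ : Y² = X³ − 2940X² + 2195200X`, `b′ = 2⁸·5²·7³` (`[b′] = [7]`): every affine `X ≠ 0` is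
  `> 0` (`X² − 2940X + 2195200 = (X − 1470)² + 34300`), `v_p(X)` is even off `{2, 5, 7}`; `[2]`,
  `[5]`, `[10]` are dead torsors and `[14]`, `[35]`, `[70]` translate onto them by `T′`.
* `W5Descent.finite_point` — **`W⁵(ℚ)` is finite**, by `finite_point_of_twoIsogenyDescent`
  (`TwoIsogenyDescent.lean`: `E(ℚ) = 2E(ℚ) + {O, T}` from the two class statements, and the tree's
  PROVED Mordell–Weil theorem `addGroup_fg_point_holds`, *AEC* VIII.6.7).

HONEST STATUS: theorems about the rational points of ONE explicit elliptic curve over `ℚ` and its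
`2`-isogenous curve; nothing here is a modularity or BSD statement; nothing here proves modularity
of a new class of elliptic curves.  References: [SilvermanAEC2009] X.4.9 (descent via
two-isogeny), VIII.6.7; Silverman–Tate III.5–6; LMFDB `1225.c1` / twist of Cremona `49a4` (labels
as computed by eng-8 g3, kit j320107 — not used in any proof).
-/

noncomputable section

open scoped Classical NNReal

set_option linter.dupNamespace false -- project-wide option; `Summit.Langlands.Langlands` is the mandated namespace

namespace Summit.Langlands.Langlands.Theorems.SqrtFiveQuarticCovers.W5Descent

open Literature.NumberTheory.EllipticCurves _root_.WeierstrassCurve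
  Literature.NumberTheory.EllipticCurves.KramerTwoDescent

/-! ### `α(W⁵(ℚ)) ⊆ {[1], [−8575]}` -/

/-- **`α(W⁵(ℚ)) ⊆ {[1], [−8575]}`**: on `Y² = X³ + 1470X² − 8575X` every rational point with
`X ≠ 0` has `X` or `−8575·X` a rational square (see the module docstring for the eight classes).
[folklore] -/
theorem sq_or_mul_sq {x y : ℚ}
    (h : (⟨0, 1470, 0, -8575, 0⟩ : WeierstrassCurve ℚ).toAffine.Nonsingular x y) (hx : x ≠ 0) :
    ∃ w : ℚ, x = w ^ 2 ∨ (⟨0, 1470, 0, -8575, 0⟩ : WeierstrassCurve ℚ).a₄ * x = w ^ 2 := by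
  haveI := fact_prime_seven
  haveI := fact_prime_five
  have he : y ^ 2 = x ^ 3 + ((1470 : ℤ) : ℚ) * x ^ 2 + ((-8575 : ℤ) : ℚ) * x := by
    have := (equation_iff x y).mp h.1
    push_cast; linear_combination this
  have he' : y ^ 2 = x ^ 3 + 1470 * x ^ 2 - 8575 * x := by push_cast at he; linear_combination he
  -- parities away from `5` and `7`
  have heven : ∀ p : ℕ, p.Prime → p ≠ 5 → p ≠ 7 → Even (padicValRat p x) :=
    fun p hp hp5 hp7 => by
      haveI : Fact p.Prime := ⟨hp⟩
      exact even_padicValRat_of_twoTorsionNF he hx fun hd =>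
        (eq_five_or_seven_of_dvd hp hd).elim hp5 hp7
  have hcoef : (⟨0, 1470, 0, -8575, 0⟩ : WeierstrassCurve ℚ).a₄ = -8575 := rfl
  rw [hcoef]
  have h5Q : (5 : ℚ) = ((5 : ℕ) : ℚ) := by norm_num
  have h7Q : (7 : ℚ) = ((7 : ℕ) : ℚ) := by norm_num
  -- the parity vector of `c · s` for `s ∈ {x, -x}` and `c ∈ {1, 5, 7, 35}`
  have key : ∀ s : ℚ, (∀ p : ℕ, padicValRat p s = padicValRat p x) → 0 < s →
      (Even (padicValRat 5 x) → Even (padicValRat 7 x) → ∃ r : ℚ, s = r ^ 2) ∧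
      (Even (padicValRat 5 x) → ¬ Even (padicValRat 7 x) → ∃ r : ℚ, 7 * s = r ^ 2) ∧
      (¬ Even (padicValRat 5 x) → Even (padicValRat 7 x) → ∃ r : ℚ, 5 * s = r ^ 2) ∧
      (¬ Even (padicValRat 5 x) → ¬ Even (padicValRat 7 x) → ∃ r : ℚ, 5 * (7 * s) = r ^ 2) := by
    intro s hs hspos
    have hs0 : s ≠ 0 := hspos.ne'
    have h7s0 : (7 : ℚ) * s ≠ 0 := mul_ne_zero (by norm_num) hs0
    have hevens : ∀ p : ℕ, p.Prime → p ≠ 5 → p ≠ 7 → Even (padicValRat p s) :=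
      fun p hp hp5 hp7 => by rw [hs]; exact heven p hp hp5 hp7
    refine ⟨fun h5 h7 => ?_, fun h5 h7 => ?_, fun h5 h7 => ?_, fun h5 h7 => ?_⟩
    · exact exists_sq_of_even_padicValRat hspos fun p hp => by
        by_cases hp5 : p = 5
        · subst hp5; rw [hs]; exact h5
        by_cases hp7 : p = 7
        · subst hp7; rw [hs]; exact h7
        exact hevens p hp hp5 hp7
    · exact exists_sq_of_even_padicValRat (mul_pos (by norm_num) hspos) fun p hp => by
        haveI : Fact p.Prime := ⟨hp⟩
        rw [h7Q, Curve49A1.even_padicValRat_prime_mul (by decide) hs0]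
        by_cases hp7 : p = 7
        · subst hp7; simpa [hs] using h7
        simp only [ne_eq, hp7, not_false_eq_true, true_iff]
        by_cases hp5 : p = 5
        · subst hp5; rw [hs]; exact h5
        exact hevens p hp hp5 hp7
    · exact exists_sq_of_even_padicValRat (mul_pos (by norm_num) hspos) fun p hp => by
        haveI : Fact p.Prime := ⟨hp⟩
        rw [h5Q, Curve49A1.even_padicValRat_prime_mul (by decide) hs0]
        by_cases hp5 : p = 5
        · subst hp5; simpa [hs] using h5
        simp only [ne_eq, hp5, not_false_eq_true, true_iff]
        by_cases hp7 : p = 7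
        · subst hp7; rw [hs]; exact h7
        exact hevens p hp hp5 hp7
    · exact exists_sq_of_even_padicValRat
        (mul_pos (by norm_num) (mul_pos (by norm_num) hspos)) fun p hp => by
        haveI : Fact p.Prime := ⟨hp⟩
        rw [h5Q, Curve49A1.even_padicValRat_prime_mul (by decide) h7s0, h7Q,
          Curve49A1.even_padicValRat_prime_mul (by decide) hs0]
        by_cases hp5 : p = 5
        · subst hp5; simpa [hs] using h5
        by_cases hp7 : p = 7
        · subst hp7; simpa [hs] using h7
        simp only [ne_eq, hp5, not_false_eq_true, hp7, true_iff]
        exact hevens p hp hp5 hp7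
  rcases lt_or_gt_of_ne hx with hneg | hpos
  · -- `x < 0`: work with `s = -x`
    obtain ⟨k1, k7, k5, k35⟩ := key (-x) (fun p => padicValRat.neg x) (neg_pos.mpr hneg)
    by_cases h5 : Even (padicValRat 5 x) <;> by_cases h7 : Even (padicValRat 7 x)
    · -- class `[-1]`: excluded
      exfalso
      obtain ⟨w, hw⟩ := k1 h5 h7
      have hw0 : w ≠ 0 := by rintro rfl; apply hx; linear_combination -hw
      exact neg_ne_sq he' hw0 (by linear_combination -hw)
    · -- class `[-7]`: `-8575 x = (35 r)²`
      obtain ⟨r, hr⟩ := k7 h5 h7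
      exact ⟨35 * r, Or.inr (by linear_combination 1225 * hr)⟩
    · -- class `[-5]`: excluded
      exfalso
      obtain ⟨r, hr⟩ := k5 h5 h7
      have hr0 : r ≠ 0 := by
        rintro rfl
        exact mul_ne_zero (by norm_num : (5 : ℚ) ≠ 0) (neg_ne_zero.mpr hx) (by rw [hr]; ring)
      exact negFive_mul_ne_sq he' hr0 (by linear_combination hr)
    · -- class `[-35]`: translate by `T` onto class `[5]`
      exfalso
      obtain ⟨r, hr⟩ := k35 h5 h7
      have hr0 : r ≠ 0 := by
        rintro rfl
        have : (5 : ℚ) * (7 * -x) = 0 := by rw [hr]; ring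
        exact mul_ne_zero (by norm_num : (5 : ℚ) ≠ 0)
          (mul_ne_zero (by norm_num) (neg_ne_zero.mpr hx)) this
      refine five_mul_ne_sq (transl_on_curve he' hx)
        (div_ne_zero (by norm_num) hr0 : (1225 : ℚ) / r ≠ 0) ?_
      rw [div_pow, ← hr]
      field_simp
      norm_num
  · -- `x > 0`: work with `s = x`
    obtain ⟨k1, k7, k5, k35⟩ := key x (fun p => rfl) hpos
    by_cases h5 : Even (padicValRat 5 x) <;> by_cases h7 : Even (padicValRat 7 x)
    · -- class `[1]`
      obtain ⟨w, hw⟩ := k1 h5 h7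
      exact ⟨w, Or.inl hw⟩
    · -- class `[7]`: translate by `T` onto class `[-1]`
      exfalso
      obtain ⟨r, hr⟩ := k7 h5 h7
      have hr0 : r ≠ 0 := by
        rintro rfl
        exact mul_ne_zero (by norm_num : (7 : ℚ) ≠ 0) hx (by rw [hr]; ring)
      refine neg_ne_sq (transl_on_curve he' hx) (div_ne_zero (by norm_num) hr0 : (245 : ℚ) / r ≠ 0) ?_
      rw [div_pow, ← hr]
      field_simp
      norm_num
    · -- class `[5]`: excluded
      exfalso
      obtain ⟨r, hr⟩ := k5 h5 h7
      have hr0 : r ≠ 0 := by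
        rintro rfl
        exact mul_ne_zero (by norm_num : (5 : ℚ) ≠ 0) hx (by rw [hr]; ring)
      exact five_mul_ne_sq he' hr0 hr
    · -- class `[35]`: translate by `T` onto class `[-5]`
      exfalso
      obtain ⟨r, hr⟩ := k35 h5 h7
      have hr0 : r ≠ 0 := by
        rintro rfl
        have : (5 : ℚ) * (7 * x) = 0 := by rw [hr]; ring
        exact mul_ne_zero (by norm_num : (5 : ℚ) ≠ 0) (mul_ne_zero (by norm_num) hx) this
      refine negFive_mul_ne_sq (transl_on_curve he' hx)
        (div_ne_zero (by norm_num) hr0 : (1225 : ℚ) / r ≠ 0) ?_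
      rw [div_pow, ← hr]
      field_simp
      norm_num

/-! ### `α′(W⁵′(ℚ)) ⊆ {[1], [2195200]}` -/

/-- **`α′(W⁵′(ℚ)) ⊆ {[1], [7]}`** for the `2`-isogenous curve `W⁵′ : Y² = X³ − 2940X² + 2195200X`
(`a′ = −2940`, `b′ = a² − 4b = 2195200 = 2⁸·5²·7³`): every rational point with `X ≠ 0` has `X`
or `2195200·X` a rational square (see the module docstring for the eight classes). [folklore] -/
theorem codomain_sq_or_mul_sq {X Y : ℚ}
    (h : (⟨0, 1470, 0, -8575, 0⟩ : WeierstrassCurve ℚ).twoIsogenyCodomain.toAffine.Nonsingular X Y)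
    (hX : X ≠ 0) :
    ∃ w : ℚ, X = w ^ 2 ∨ ((⟨0, 1470, 0, -8575, 0⟩ : WeierstrassCurve ℚ).a₂ ^ 2 -
      4 * (⟨0, 1470, 0, -8575, 0⟩ : WeierstrassCurve ℚ).a₄) * X = w ^ 2 := by
  haveI := fact_prime_seven
  haveI := fact_prime_five
  have he : Y ^ 2 = X ^ 3 + ((-2940 : ℤ) : ℚ) * X ^ 2 + ((2195200 : ℤ) : ℚ) * X := by
    have := WeierstrassCurve.rel_of_nonsingular
      (⟨0, 1470, 0, -8575, 0⟩ : WeierstrassCurve ℚ).twoIsogenyCodomain h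
    simp only [twoIsogenyCodomain_a₂, twoIsogenyCodomain_a₄] at this
    push_cast; linear_combination this
  have he' : Y ^ 2 = X ^ 3 - 2940 * X ^ 2 + 2195200 * X := by
    push_cast at he; linear_combination he
  -- positivity
  have hpos : 0 < X := by
    have hq : 0 < (X - 1470) ^ 2 + 34300 := by positivity
    have hprod : X * ((X - 1470) ^ 2 + 34300) = Y ^ 2 := by linear_combination -he'
    by_contra hle
    have hlt : X < 0 := lt_of_le_of_ne (not_lt.mp hle) hX
    nlinarith [sq_nonneg Y, mul_neg_of_neg_of_pos hlt hq]
  -- parities away from `2`, `5`, `7`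
  have heven : ∀ p : ℕ, p.Prime → p ≠ 2 → p ≠ 5 → p ≠ 7 → Even (padicValRat p X) :=
    fun p hp hp2 hp5 hp7 => by
      haveI : Fact p.Prime := ⟨hp⟩
      exact even_padicValRat_of_twoTorsionNF he hX fun hd => by
        rcases eq_two_or_five_or_seven_of_dvd hp hd with h | h | h
        · exact hp2 h
        · exact hp5 h
        · exact hp7 h
  have hcoef : (⟨0, 1470, 0, -8575, 0⟩ : WeierstrassCurve ℚ).a₂ ^ 2 -
      4 * (⟨0, 1470, 0, -8575, 0⟩ : WeierstrassCurve ℚ).a₄ = 2195200 := by norm_num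
  rw [hcoef]
  have h2Q : (2 : ℚ) = ((2 : ℕ) : ℚ) := by norm_num
  have h5Q : (5 : ℚ) = ((5 : ℕ) : ℚ) := by norm_num
  have h7Q : (7 : ℚ) = ((7 : ℕ) : ℚ) := by norm_num
  have h7X0 : (7 : ℚ) * X ≠ 0 := mul_ne_zero (by norm_num) hX
  have h57X0 : (5 : ℚ) * (7 * X) ≠ 0 := mul_ne_zero (by norm_num) h7X0
  have h5X0 : (5 : ℚ) * X ≠ 0 := mul_ne_zero (by norm_num) hX
  -- `c · X` is a square for the matching `c ∈ {1, 7, 5, 35, 2, 14, 10, 70}`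
  -- odd part first: `t = X`, `7X`, `5X` or `35X` has even valuations at all odd primes
  have hodd : ∃ t : ℚ, 0 < t ∧ (t = X ∨ t = 7 * X ∨ t = 5 * X ∨ t = 5 * (7 * X)) ∧
      ∀ p : ℕ, p.Prime → p ≠ 2 → Even (padicValRat p t) := by
    by_cases h5 : Even (padicValRat 5 X) <;> by_cases h7 : Even (padicValRat 7 X)
    · refine ⟨X, hpos, Or.inl rfl, fun p hp hp2 => ?_⟩
      by_cases hp5 : p = 5
      · subst hp5; exact h5
      by_cases hp7 : p = 7
      · subst hp7; exact h7
      exact heven p hp hp2 hp5 hp7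
    · refine ⟨7 * X, mul_pos (by norm_num) hpos, Or.inr (Or.inl rfl), fun p hp hp2 => ?_⟩
      haveI : Fact p.Prime := ⟨hp⟩
      rw [h7Q, Curve49A1.even_padicValRat_prime_mul (by decide) hX]
      by_cases hp7 : p = 7
      · subst hp7; simpa using h7
      simp only [ne_eq, hp7, not_false_eq_true, true_iff]
      by_cases hp5 : p = 5
      · subst hp5; exact h5
      exact heven p hp hp2 hp5 hp7
    · refine ⟨5 * X, mul_pos (by norm_num) hpos, Or.inr (Or.inr (Or.inl rfl)), fun p hp hp2 => ?_⟩
      haveI : Fact p.Prime := ⟨hp⟩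
      rw [h5Q, Curve49A1.even_padicValRat_prime_mul (by decide) hX]
      by_cases hp5 : p = 5
      · subst hp5; simpa using h5
      simp only [ne_eq, hp5, not_false_eq_true, true_iff]
      by_cases hp7 : p = 7
      · subst hp7; exact h7
      exact heven p hp hp2 hp5 hp7
    · refine ⟨5 * (7 * X), mul_pos (by norm_num) (mul_pos (by norm_num) hpos),
        Or.inr (Or.inr (Or.inr rfl)), fun p hp hp2 => ?_⟩
      haveI : Fact p.Prime := ⟨hp⟩
      rw [h5Q, Curve49A1.even_padicValRat_prime_mul (by decide) h7X0, h7Q,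
        Curve49A1.even_padicValRat_prime_mul (by decide) hX]
      by_cases hp5 : p = 5
      · subst hp5; simpa using h5
      by_cases hp7 : p = 7
      · subst hp7; simpa using h7
      simp only [ne_eq, hp5, not_false_eq_true, hp7, true_iff]
      exact heven p hp hp2 hp5 hp7
  obtain ⟨t, htpos, ht, htev⟩ := hodd
  have ht0 : t ≠ 0 := htpos.ne'
  -- then `t` or `2t` is a square
  have hsq : (∃ r : ℚ, t = r ^ 2) ∨ (∃ r : ℚ, 2 * t = r ^ 2) := by
    by_cases h2 : Even (padicValRat 2 t)
    · refine Or.inl (exists_sq_of_even_padicValRat htpos fun p hp => ?_)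
      by_cases hp2 : p = 2
      · subst hp2; exact h2
      exact htev p hp hp2
    · refine Or.inr (exists_sq_of_even_padicValRat (mul_pos (by norm_num) htpos) fun p hp => ?_)
      haveI : Fact p.Prime := ⟨hp⟩
      rw [h2Q, Curve49A1.even_padicValRat_prime_mul Nat.prime_two ht0]
      by_cases hp2 : p = 2
      · subst hp2; simpa using h2
      simp only [ne_eq, hp2, not_false_eq_true, true_iff]
      exact htev p hp hp2
  rcases hsq with ⟨r, hr⟩ | ⟨r, hr⟩
  · -- `t = r²`
    have hr0 : r ≠ 0 := by rintro rfl; exact ht0 (by rw [hr]; ring)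
    rcases ht with rfl | rfl | rfl | rfl
    · exact ⟨r, Or.inl hr⟩
    · exact ⟨560 * r, Or.inr (by linear_combination 313600 * hr)⟩
    · exact (co_five_mul_ne_sq he' hr0 hr).elim
    · -- `35 X = r²`: translate by `T′` onto class `[5]`
      exfalso
      refine co_five_mul_ne_sq (co_transl_on_curve he' hX)
        (div_ne_zero (by norm_num) hr0 : (19600 : ℚ) / r ≠ 0) ?_
      rw [div_pow, ← hr]
      field_simp
      norm_num
  · -- `2t = r²`
    have hr0 : r ≠ 0 := by
      rintro rfl
      exact mul_ne_zero (by norm_num : (2 : ℚ) ≠ 0) ht0 (by rw [hr]; ring)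
    rcases ht with rfl | rfl | rfl | rfl
    · exact (co_two_mul_ne_sq he' hr0 hr).elim
    · -- `14 X = r²`: translate by `T′` onto class `[2]`
      exfalso
      refine co_two_mul_ne_sq (co_transl_on_curve he' hX)
        (div_ne_zero (by norm_num) hr0 : (7840 : ℚ) / r ≠ 0) ?_
      rw [div_pow, ← hr]
      field_simp
      norm_num
    · -- `10 X = r²`
      exact (co_ten_mul_ne_sq he' hr0 (by linear_combination hr)).elim
    · -- `70 X = r²`: translate by `T′` onto class `[10]`
      exfalso
      refine co_ten_mul_ne_sq (co_transl_on_curve he' hX)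
        (div_ne_zero (by norm_num) hr0 : (39200 : ℚ) / r ≠ 0) ?_
      rw [div_pow, ← hr]
      field_simp
      norm_num

/-! ### `W⁵(ℚ)` is finite (rank `0`) -/

/-- **`W⁵(ℚ)` is finite**: descent via `2`-isogeny (`finite_point_of_twoIsogenyDescent`, with
`α ⊆ {[1],[−8575]}`, `α′ ⊆ {[1],[2195200]}`) and the tree's Mordell–Weil theorem.  In LMFDB terms
this is «`1225.c1` (the `5`-twist of `49a4`): `r = 0`». [cite: SilvermanAEC2009, X.4.9] -/
theorem finite_point : Finite (⟨0, 1470, 0, -8575, 0⟩ : WeierstrassCurve ℚ).toAffine.Point := by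
  haveI := isElliptic
  exact finite_point_of_twoIsogenyDescent (⟨0, 1470, 0, -8575, 0⟩ : WeierstrassCurve ℚ)
    (fun h hx => sq_or_mul_sq h hx) (fun h hX => codomain_sq_or_mul_sq h hX)

end Summit.Langlands.Langlands.Theorems.SqrtFiveQuarticCovers.W5Descent

end
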